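import Summits.NavierStokesRegularity.FunctionalMining.TopEigJensen
import Literature.Analysis.FunctionSpaces.TorusConvolution
import HarnessLib

/-!
# FunctionalMining — mollified fields: `S(θ ⋆ v) = θ ⋆ S(v)` and Proposition 4′ for velocity fields

Search for candidate a priori estimates; no regularity claim. Cell `pub-nsfunc`, prove seat
(gen 21). Completes the kernel form of the no-go seat's F1 PART I Proposition 4 (4′) ("constant
selections survive mollification"; pen, countersigned in the cell — not a cited fact) for actual
velocity fields: `TopEigJensen.lean` has the Jensen step for abstract weighted averages of tensors;
here the mollification `θ ⋆ v` of a field on the torus (Mathlib's group convolution,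
`(θ ⋆ v)(x) = ∫ θ(t) v(x − t) dt`, the tree's `Literature.Analysis.FunctionSpaces.TorusConvolution`) is
identified:

* `TopEig.convolution_comp_clm` — a continuous linear map of the values commutes with mollification;
* **`TopEig.strainFlat_convolution`** — `S(θ ⋆ v)(x) = (θ ⋆ S(v))(x)` for `θ ∈ L¹(T^d)` and smooth
  `v` (`∂ᵢ(θ ⋆ k) = θ ⋆ ∂ᵢk`, Evans App. C.4 Thm. 7 (i), tree `Torus.partialDeriv_convolution`);
* **`TopEig.lam_strainFlat_convolution_le`** — for a kernel `θ ≥ 0`: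
  `λ₁(S(θ ⋆ v))(x) ≤ (θ ⋆ λ₁(S(v)))(x)` (Jensen);
* **`TopEig.lam_strainFlat_convolution_eq_of_const_top`** — if moreover ONE constant unit vector `e`
  is a top vector of `S(v)(x − t)` for every `t` with `θ(t) ≠ 0`, then equality holds and `e` is a top
  vector of `S(θ ⋆ v)(x)` (wells and `[0,1]`-profile twin walls stay free under mollification,
  `TopEigTwinWall`, `TopEigSelectionBound`).

[ours; folklore]
-/

noncomputable section

open MeasureTheory Set ContinuousLinearMap
open scoped Convolution

namespace Summit.NavierStokesRegularity.FunctionalMining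

open Literature.Analysis.FunctionSpaces Literature.Analysis.FluidPDE

namespace TopEig

variable {d : Type*} [Fintype d] [DecidableEq d] [Nonempty d]

/-! ## 1. Linear maps of the values commute with mollification -/

section CLM

variable {F G : Type*} [NormedAddCommGroup F] [NormedSpace ℝ F] [NormedAddCommGroup G]
  [NormedSpace ℝ G] [CompleteSpace F] [CompleteSpace G]

omit [DecidableEq d] [Nonempty d] in
/-- `(θ ⋆ (L ∘ k))(x) = L((θ ⋆ k)(x))` for a continuous linear `L`, `θ ∈ L¹`, `k` continuous
(the Bochner integral commutes with `L`). [folklore] -/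
theorem convolution_comp_clm {θ : UnitAddTorus d → ℝ} (hθ : Integrable θ volume)
    {k : UnitAddTorus d → F} (hk : Continuous k) (L : F →L[ℝ] G) (x : UnitAddTorus d) :
    (θ ⋆ fun y => L (k y)) x = L ((θ ⋆ k) x) := by
  rw [convolution_lsmul, convolution_lsmul,
    ← L.integral_comp_comm (Torus.integrable_smul_comp_sub hθ hk x)]
  simp only [map_smul]

end CLM

/-! ## 2. The strain commutes with mollification -/

variable {θ : UnitAddTorus d → ℝ} {v : UnitAddTorus d → EuclideanSpace ℝ d}

omit [DecidableEq d] [Nonempty d] in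
/-- Coordinates of a mollified vector field: `((θ ⋆ w)(x))ᵢ = (θ ⋆ wᵢ)(x)`. [folklore] -/
theorem convolution_apply_coord {ι : Type*} [Fintype ι] (hθ : Integrable θ volume)
    {w : UnitAddTorus d → EuclideanSpace ℝ ι} (hw : Continuous w) (x : UnitAddTorus d) (p : ι) :
    (θ ⋆ w) x p = (θ ⋆ fun y => w y p) x := by
  have h := convolution_comp_clm hθ hw (EuclideanSpace.proj p : EuclideanSpace ℝ ι →L[ℝ] ℝ) x
  exact h.symm

omit [DecidableEq d] [Nonempty d] in
/-- Mollification is linear in the kernel: `θ ⋆ ((a + b)/2) = ((θ ⋆ a) + (θ ⋆ b))/2` pointwise, for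
continuous real `a, b`. [folklore] -/
theorem convolution_half_add {a b : UnitAddTorus d → ℝ} (hθ : Integrable θ volume) (ha : Continuous a)
    (hb : Continuous b) (x : UnitAddTorus d) :
    (θ ⋆ fun y => (a y + b y) / 2) x = ((θ ⋆ a) x + (θ ⋆ b) x) / 2 := by
  have hia : Integrable (fun t => θ t * a (x - t)) volume := by
    simpa only [smul_eq_mul] using Torus.integrable_smul_comp_sub hθ ha x
  have hib : Integrable (fun t => θ t * b (x - t)) volume := by
    simpa only [smul_eq_mul] using Torus.integrable_smul_comp_sub hθ hb x
  simp only [convolution_lsmul, smul_eq_mul]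
  rw [← integral_add hia hib, ← integral_div]
  refine integral_congr_ae (ae_of_all _ fun t => ?_)
  ring

omit [Nonempty d] in
/-- **The strain commutes with mollification**: `S(θ ⋆ v)(x) = (θ ⋆ S(v))(x)` for `θ ∈ L¹(T^d)` and
smooth `v` (derivatives commute with convolution, Evans App. C.4 Thm. 7 (i)). [folklore] -/
theorem strainFlat_convolution (hθ : Integrable θ volume) (hv : Torus.IsSmooth v) (x : UnitAddTorus d) :
    StrainL4.strainFlat (θ ⋆ v) x = (θ ⋆ StrainL4.strainFlat v) x := by
  ext p
  obtain ⟨i, j⟩ := p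
  rw [StrainL4.strainFlat_apply, Torus.partialDeriv_convolution hθ hv j x,
    Torus.partialDeriv_convolution hθ hv i x,
    convolution_apply_coord hθ (hv.partialDeriv j).continuous x i,
    convolution_apply_coord hθ (hv.partialDeriv i).continuous x j,
    convolution_apply_coord hθ (StrainL4.continuous_strainFlat hv) x (i, j)]
  have ha : Continuous fun y => Torus.partialDeriv j v y i :=
    (EuclideanSpace.proj i).continuous.comp (hv.partialDeriv j).continuous
  have hb : Continuous fun y => Torus.partialDeriv i v y j :=
    (EuclideanSpace.proj j).continuous.comp (hv.partialDeriv i).continuous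
  rw [← convolution_half_add hθ ha hb x]
  rfl

/-! ## 3. Proposition 4′ for velocity fields -/

/-- **Jensen under mollification of a field**: for a kernel `θ ≥ 0` in `L¹(T^d)` and smooth `v`,
`λ₁(S(θ ⋆ v))(x) ≤ (θ ⋆ λ₁(S(v)))(x) = ∫ θ(t) λ₁(S(v))(x − t) dt`. [ours; F1 PART I Prop. 4′] -/
theorem lam_strainFlat_convolution_le (hθ : Integrable θ volume) (hθ0 : ∀ t, 0 ≤ θ t)
    (hv : Torus.IsSmooth v) (x : UnitAddTorus d) :
    lam (StrainL4.strainFlat (θ ⋆ v) x) ≤ (θ ⋆ fun y => lam (StrainL4.strainFlat v y)) x := by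
  rw [strainFlat_convolution hθ hv x, convolution_lsmul, convolution_lsmul]
  simp only [smul_eq_mul]
  have hS : Continuous fun t => StrainL4.strainFlat v (x - t) :=
    (StrainL4.continuous_strainFlat hv).comp (continuous_const.sub continuous_id)
  exact lam_integral_smul_le hθ0 (Torus.integrable_smul_comp_sub hθ (StrainL4.continuous_strainFlat hv) x)
    (by
      have h := Torus.integrable_smul_comp_sub hθ (continuous_lam.comp (StrainL4.continuous_strainFlat hv)) x
      simpa only [smul_eq_mul, Function.comp] using h)

/-- **Constant top vectors survive mollification (F1 PART I Prop. 4′, field form).** If `θ ≥ 0` is in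
`L¹`, `v` is smooth, and ONE fixed unit vector `e` is a top vector of `S(v)(x − t)` for every `t` with
`θ(t) ≠ 0`, then `λ₁(S(θ ⋆ v))(x) = (θ ⋆ λ₁(S(v)))(x)` and `e ∈ E(S(θ ⋆ v)(x))`. [ours; F1 PART I
Prop. 4′] -/
theorem lam_strainFlat_convolution_eq_of_const_top (hθ : Integrable θ volume) (hθ0 : ∀ t, 0 ≤ θ t)
    (hv : Torus.IsSmooth v) (x : UnitAddTorus d) {e : d → ℝ} (he0 : e ∈ unitSphere d)
    (he : ∀ t, θ t ≠ 0 → e ∈ topEigSet (StrainL4.strainFlat v (x - t))) :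
    lam (StrainL4.strainFlat (θ ⋆ v) x) = (θ ⋆ fun y => lam (StrainL4.strainFlat v y)) x ∧
      e ∈ topEigSet (StrainL4.strainFlat (θ ⋆ v) x) := by
  have hint : Integrable (fun t => θ t • StrainL4.strainFlat v (x - t)) volume :=
    Torus.integrable_smul_comp_sub hθ (StrainL4.continuous_strainFlat hv) x
  have hlam : Integrable (fun t => θ t * lam (StrainL4.strainFlat v (x - t))) volume := by
    have h := Torus.integrable_smul_comp_sub hθ (continuous_lam.comp (StrainL4.continuous_strainFlat hv)) x
    simpa only [smul_eq_mul, Function.comp] using h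
  have h1 := lam_integral_smul_eq_of_const_top he0 hθ0 hint hlam (ae_of_all _ he)
  have h2 := mem_topEigSet_integral_smul he0 hθ0 hint hlam (ae_of_all _ he)
  rw [strainFlat_convolution hθ hv x, convolution_lsmul, convolution_lsmul]
  simp only [smul_eq_mul]
  exact ⟨h1, h2⟩

end TopEig

end Summit.NavierStokesRegularity.FunctionalMining

end
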